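import Literature.NumberTheory.ComplexMultiplication.MainTheoremCMLevelPrime
import Literature.NumberTheory.ComplexMultiplication.MainTheoremCMLevelData
import Literature.AlgebraicGeometry.Motives.GoodReductionProofs
import Literature.AlgebraicGeometry.Motives.AbelianVarietyProjectiveChart
import HarnessLib

/-!
# The main theorem of complex multiplication — Shimura's prime `𝔓` TOGETHER WITH the reduction data of a finite family,
# at EVERY prime `ℓ' ∤ 𝔓` (S7a plumbing G5 → G8) [Shimura 1998, §18.6 proof of Thm. 18.6, p. 128 (1)–(4), p. 129]

Topic `Literature/NumberTheory/ComplexMultiplication`, namespace `Literature.NumberTheory.ComplexMultiplication`.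
THEOREMS ONLY (no definition, no named fact, no instance; net Literature debt **0**).  Cell `hodgecm-mathlib` (D-0151),
fan B-II, line `b2_main_theorem_cm` (crux item stmt-HodgeConjecture-24834, row II-1 `shimura1998_thm18_6`), stub S7a
«level structure» (`levelStructure`; S7a pen B-p15, harness `S7aHarness.core`): the PLUMBING between piece G5 (B-p12 p607188
`exists_frobeniusPrime`: Čebotarev gives a degree-one prime `𝔓 = v` of `L`, away from a finite set and from `M`, at which `g`
is THE Frobenius) and piece G8 (A-p01 p607958 `exists_levelReductionData_family` / `_pair`: the reduction data of a family with
good reduction at `v` from the three reduction-theory named facts AS HYPOTHESES) — director g2 BATCH 19 cut (i) — in the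
ALL-PRIMES form the torsion step needs (B-p19 2026-08-28T05:58:44Z: F-S5c must be instantiated at EVERY prime `ℓ' ∣ N`, not
only at the polarisation prime, with the SAME good-reduction and pair data):

* `exists_levelReductionData_family_forall_prime` / `exists_levelReductionData_pair_forall_prime` — G8 with the `ℓ`-free data
  (`R`, `H`, `Hγ`, `Hγ'`; resp. `R`, `Rᵢ`, `H0i`, `Hi0`, `Hiγ`, `Hγi`, `H0γ`, `Hγ0`) chosen ONCE and the `ℓ`-adic part (`T`, `Tγ`,
  `σ̃`, (σ-a), (σ-b), compatibilities, (2′)) delivered for every prime `ℓ` with `v ∤ ℓ`;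
* `exists_frobeniusPrime_goodReduction` — G5 run OUTSIDE the bad-reduction sets of a finite family `A : ι → AbelianVariety L`
  (`exists_finite_hasGoodReductionOutside_holds` + `AbelianVariety.isSmoothProjective_holds`, both PROVED in the tree), so that
  every member has good reduction at `v` (Shimura p. 128 condition (2) «every member of 𝔄 has good reduction modulo 𝔓»),
  plus «`d ∣ M`, `(M) ∉ v` ⇒ `(d) ∉ v`» (so `v ∤ ℓ'` for every `ℓ' ∣ M`);
* `exists_frobeniusPrime_levelReductionData` — the two composed: ONE existential opening `v`, the residue characteristic `p`
  (`q = p`), `[ExpChar κ(v) p]`, `hγ`, `hq`, conditions (1)–(4), good reduction of every member, the `ℓ`-free reduction data, and,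
  for every prime `ℓ'` with `v ∤ ℓ'`, the F-S5c body verbatim at `(γ, n) := (g, 1)`.  The G8 → G10 step (B-p12 g3) and the
  torsion descent (B-p09/B-p19) start from this `obtain`.

HC_CM is proved only modulo the 7 printed citations until rung 0 closes; this file adds no hypothesis (its three hypotheses
are the line's `FactGR` / `FactHR` / `FactS5c`, character for character).

## References
* [Shimura1998] G. Shimura, *Abelian Varieties with Complex Multiplication and Modular Functions*, Princeton Univ. Press
  (1998): §18.6 proof of Thm. 18.6, p. 128 (conditions (1)–(4) on `𝔓`, held chunk p0166 L5–L12), p. 129; §11.1 Prop. 12,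
  Prop. 14 (i).
* [SerreTate1968] J.-P. Serre, J. Tate, *Good reduction of abelian varieties*, Ann. of Math. 88 (1968), §1.
-/

set_option autoImplicit false

open NumberField IsDedekindDomain
open Literature.AlgebraicGeometry.Motives Literature.AlgebraicGeometry.Motives.AbelianVariety
open Literature.AlgebraicGeometry.Motives.AbelianVariety.GoodReductionAt
open Literature.NumberTheory.GaloisRepresentations

namespace Literature.NumberTheory.ComplexMultiplication

/-! ## G8 with the `ℓ`-free data chosen once (all primes `ℓ ∤ v`) -/

/-- **G8 «DATA», family form, ALL PRIMES.**  From `hGR`, `hHR`, `hS5c` (the line's `FactGR` / `FactHR` / `FactS5c` verbatim): for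
a family `A : ι → AbelianVariety K` with good reduction at `v`, an index `a` and an arithmetic Frobenius `γ` at `v` (`q = pⁿ`), there
are good-reduction data `R i`, pair data `H i j`, `Hγ i`, `Hγ' i` (towards the constructed conjFrob datum of `A a`) — chosen ONCE —
such that for EVERY prime `ℓ` the named fact `exists_isTateCompatible_family_conjFrob R H a γ hγ p n hq Hγ Hγ' ℓ` holds (i.e. for
`v ∤ ℓ`: `T`, `Tγ`, `σ̃`, (σ-a), (σ-b), one common prime, every Tate compatibility, (2′)).  Pure composition; [Shimura1998, §11.1
Prop. 12, Prop. 14 (i); §18.6 p. 129]. [cite: Shimura1998, §18.6 proof of Thm. 18.6, p. 129; §11.1 Prop. 12, Prop. 14 (i)] -/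
theorem exists_levelReductionData_family_forall_prime
    (hGR : ∀ {k : Type} [Field k] [NumberField k] (A₀ : AbelianVariety k) (v : HeightOneSpectrum (𝓞 k)),
      AbelianVariety.nonempty_goodReductionAt A₀ v)
    (hHR : ∀ {k : Type} [Field k] [NumberField k] {A₀ B₀ : AbelianVariety k} {v : HeightOneSpectrum (𝓞 k)}
      (R : A₀.GoodReductionAt v) (S : B₀.GoodReductionAt v), HomReduction.nonempty_homReduction R S)
    (hS5c : ∀ {F₀ k : Type} [Field F₀] [NumberField F₀] [Field k] [NumberField k] [Algebra F₀ k]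
      {v : HeightOneSpectrum (𝓞 k)} {ι : Type} {A : ι → AbelianVariety k}
      (R : ∀ i, (A i).GoodReductionAt v) (H : ∀ i j, HomReduction (R i) (R j)) (a : ι)
      (γ : k ≃ₐ[F₀] k) (hγ : IsArithFrobAt (𝓞 F₀) γ v.asIdeal) (p n : ℕ) [ExpChar v.asIdeal.ResidueField p]
      (hq : Nat.card (𝓞 F₀ ⧸ v.asIdeal.under (𝓞 F₀)) = p ^ n)
      (Hγ : ∀ i, HomReduction (R i) ((R a).conjFrob γ hγ p n hq))
      (Hγ' : ∀ i, HomReduction ((R a).conjFrob γ hγ p n hq) (R i)) (ℓ : ℕ) [Fact ℓ.Prime],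
      HomReduction.exists_isTateCompatible_family_conjFrob R H a γ hγ p n hq Hγ Hγ' ℓ)
    {F₀ K : Type} [Field F₀] [NumberField F₀] [Field K] [NumberField K] [Algebra F₀ K]
    {v : HeightOneSpectrum (𝓞 K)} {ι : Type} (A : ι → AbelianVariety K)
    (hA : ∀ i, HasGoodReductionAt (A i).X (A i).dim v) (a : ι)
    (γ : K ≃ₐ[F₀] K) (hγ : IsArithFrobAt (𝓞 F₀) γ v.asIdeal) (p n : ℕ) [ExpChar v.asIdeal.ResidueField p]
    (hq : Nat.card (𝓞 F₀ ⧸ v.asIdeal.under (𝓞 F₀)) = p ^ n) :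
    ∃ (R : ∀ i, (A i).GoodReductionAt v) (H : ∀ i j, HomReduction (R i) (R j))
      (Hγ : ∀ i, HomReduction (R i) ((R a).conjFrob γ hγ p n hq))
      (Hγ' : ∀ i, HomReduction ((R a).conjFrob γ hγ p n hq) (R i)),
      ∀ (ℓ : ℕ) [Fact ℓ.Prime], HomReduction.exists_isTateCompatible_family_conjFrob R H a γ hγ p n hq Hγ Hγ' ℓ := by
  classical
  let R : ∀ i, (A i).GoodReductionAt v := fun i => Classical.choice (hGR (A i) v (hA i))
  let H : ∀ i j, HomReduction (R i) (R j) := fun i j => Classical.choice (hHR (R i) (R j))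
  let Hγ : ∀ i, HomReduction (R i) ((R a).conjFrob γ hγ p n hq) :=
    fun i => Classical.choice (hHR (R i) ((R a).conjFrob γ hγ p n hq))
  let Hγ' : ∀ i, HomReduction ((R a).conjFrob γ hγ p n hq) (R i) :=
    fun i => Classical.choice (hHR ((R a).conjFrob γ hγ p n hq) (R i))
  exact ⟨R, H, Hγ, Hγ', fun ℓ _ => hS5c R H a γ hγ p n hq Hγ Hγ' ℓ⟩

/-- **G8 «DATA», pair form, ALL PRIMES — the `ℓ`-free binders of the CORE (G10) chosen once, the `ℓ`-adic ones for every `ℓ ∤ v`.**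
From `hGR`, `hHR`, `hS5c` for the two `L`-varieties `A₀`, `Aᵢ` with good reduction at `v` and an arithmetic Frobenius `γ` at `v`
(`q = pⁿ`): `R`, `Rᵢ`, `H0i`, `Hi0`, `Hiγ`, `Hγi`, `H0γ`, `Hγ0` (towards `R.conjFrob γ hγ p n hq`) such that for every prime `ℓ` with
`v ∤ ℓ` there are `T0`, `Ti`, `Tγ` with the six Tate compatibilities, `σ̃ ∈ Aut(L̄)` over `γ` with (σ-b), one common prime, and the
geometric torsion clause (2′) on `A₀[ℓᵐ](L̄)` — F-S5c at `![A₀, Aᵢ]`, `a := 0`, every `ℓ`.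
[cite: Shimura1998, §18.6 proof of Thm. 18.6, pp. 128–130; §11.1 Prop. 12, Prop. 14 (i)] -/
theorem exists_levelReductionData_pair_forall_prime
    (hGR : ∀ {k : Type} [Field k] [NumberField k] (A₀ : AbelianVariety k) (v : HeightOneSpectrum (𝓞 k)),
      AbelianVariety.nonempty_goodReductionAt A₀ v)
    (hHR : ∀ {k : Type} [Field k] [NumberField k] {A₀ B₀ : AbelianVariety k} {v : HeightOneSpectrum (𝓞 k)}
      (R : A₀.GoodReductionAt v) (S : B₀.GoodReductionAt v), HomReduction.nonempty_homReduction R S)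
    (hS5c : ∀ {F₀ k : Type} [Field F₀] [NumberField F₀] [Field k] [NumberField k] [Algebra F₀ k]
      {v : HeightOneSpectrum (𝓞 k)} {ι : Type} {A : ι → AbelianVariety k}
      (R : ∀ i, (A i).GoodReductionAt v) (H : ∀ i j, HomReduction (R i) (R j)) (a : ι)
      (γ : k ≃ₐ[F₀] k) (hγ : IsArithFrobAt (𝓞 F₀) γ v.asIdeal) (p n : ℕ) [ExpChar v.asIdeal.ResidueField p]
      (hq : Nat.card (𝓞 F₀ ⧸ v.asIdeal.under (𝓞 F₀)) = p ^ n)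
      (Hγ : ∀ i, HomReduction (R i) ((R a).conjFrob γ hγ p n hq))
      (Hγ' : ∀ i, HomReduction ((R a).conjFrob γ hγ p n hq) (R i)) (ℓ : ℕ) [Fact ℓ.Prime],
      HomReduction.exists_isTateCompatible_family_conjFrob R H a γ hγ p n hq Hγ Hγ' ℓ)
    {F₀ L : Type} [Field F₀] [NumberField F₀] [Field L] [NumberField L] [Algebra F₀ L]
    (A₀ Aᵢ : AbelianVariety L) (v : HeightOneSpectrum (𝓞 L))
    (h₀ : HasGoodReductionAt A₀.X A₀.dim v) (hᵢ : HasGoodReductionAt Aᵢ.X Aᵢ.dim v)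
    (γ : L ≃ₐ[F₀] L) (hγ : IsArithFrobAt (𝓞 F₀) γ v.asIdeal) (p n : ℕ) [ExpChar v.asIdeal.ResidueField p]
    (hq : Nat.card (𝓞 F₀ ⧸ v.asIdeal.under (𝓞 F₀)) = p ^ n) :
    ∃ (R : A₀.GoodReductionAt v) (Rᵢ : Aᵢ.GoodReductionAt v)
      (H0i : HomReduction R Rᵢ) (Hi0 : HomReduction Rᵢ R)
      (Hiγ : HomReduction Rᵢ (R.conjFrob γ hγ p n hq)) (Hγi : HomReduction (R.conjFrob γ hγ p n hq) Rᵢ)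
      (H0γ : HomReduction R (R.conjFrob γ hγ p n hq)) (Hγ0 : HomReduction (R.conjFrob γ hγ p n hq) R),
      ∀ (ℓ : ℕ) [Fact ℓ.Prime] (hℓv : (ℓ : 𝓞 L) ∉ v.asIdeal),
      ∃ (T0 : R.TateSpecialisation ℓ) (Ti : Rᵢ.TateSpecialisation ℓ) (Tγ : (R.conjFrob γ hγ p n hq).TateSpecialisation ℓ)
        (_h0i : H0i.IsTateCompatible T0 Ti) (_hi0 : Hi0.IsTateCompatible Ti T0)
        (_hiγT : Hiγ.IsTateCompatible Ti Tγ) (_hγiT : Hγi.IsTateCompatible Tγ Ti)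
        (_h0γ : H0γ.IsTateCompatible T0 Tγ) (_hγ0 : Hγ0.IsTateCompatible Tγ T0)
        (σ' : AlgebraicClosure L ≃+* AlgebraicClosure L)
        -- (σ-a) `σ̃` extends `γ`
        (hσa : ∀ x : L, σ' (algebraMap L (AlgebraicClosure L) x) = algebraMap L (AlgebraicClosure L) (γ.toRingEquiv x)),
        -- (σ-b) `σ̃` is the `q`-th power map on the `ℓ`-power roots of unity
        (∀ (m : ℕ) (ζ : AlgebraicClosure L), ζ ^ (ℓ ^ m) = 1 → σ' ζ = ζ ^ (p ^ n)) ∧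
        -- one common prime
        T0.prime = Ti.prime ∧ Tγ.prime = T0.prime ∧
        -- (2′) the GEOMETRIC torsion clause «(x^σ̃)~ = π(x̃)» on A₀[ℓᵐ](K̄), the conjugate point read through (A^γ) ⊗ K̄ ≅ (A ⊗ K̄)^σ̃
        (∀ (m : ℕ) (x : A₀.geomTorsion (ℓ ^ m : ℕ)) (x' : (A₀.conjugate γ.toRingEquiv).geomTorsion (ℓ ^ m : ℕ)),
          Additive.toMul (x' : (A₀.conjugate γ.toRingEquiv).geomPoints) =
            ((A₀.conjugate γ.toRingEquiv).pointsMulEquiv (AlgebraicClosure L)).symm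
              (AlgPoints.map (conjugateBaseChangeAlongIso γ.toRingEquiv σ' hσa A₀).inv.hom.hom.hom
                ((A₀.baseChange (AlgebraicClosure L)).conjPoints σ'
                  (A₀.pointsMulEquiv (AlgebraicClosure L) (Additive.toMul (x : A₀.geomPoints))))) →
          (Tγ.reductionTorsionEquiv hℓv m x' : (R.conjFrob γ hγ p n hq).reduction.geomPoints) =
            Hom.geomPointsMap (R.reduction.relFrobenius p n)
              (T0.reductionTorsionEquiv hℓv m x : R.reduction.geomPoints)) := by
  classical
  obtain ⟨R, H, Hγ, Hγ', hdata⟩ :=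
    exists_levelReductionData_family_forall_prime hGR hHR hS5c (v := v) ![A₀, Aᵢ]
      (fun i => by fin_cases i <;> assumption) 0 γ hγ p n hq
  refine ⟨R 0, R 1, H 0 1, H 1 0, Hγ 1, Hγ' 1, Hγ 0, Hγ' 0, fun ℓ _ hℓv => ?_⟩
  obtain ⟨T, Tγ, σ', hσa, hσb, hTT, hTγ, hH, hHγ, hHγ', h2⟩ := hdata ℓ hℓv
  exact ⟨T 0, T 1, Tγ, hH 0 1, hH 1 0, hHγ 1, hHγ' 1, hHγ 0, hHγ' 0, σ', hσa, hσb, hTT 0 1, hTγ 0, h2⟩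

/-! ## Shimura's prime with good reduction of a family, and everything at once -/

/-- **Shimura's prime `𝔓` with good reduction of a finite family (p. 128, conditions (1)–(4) with (2) for every member
of `𝔄`).**  For `g ∈ Gal(L/F)` (`L/F` finite Galois), a finite set `S` of places of `L`, `M ≠ 0`, and a FINITE family
`A : ι → AbelianVariety L`: a place `v` of `L` and a rational prime `p` with `v ∉ S`, `p ∤ M`, `(p) ⊆ v`, `(M) ∉ v` — hence
**`(d) ∉ v` for every `d ∣ M`** —, `κ(v)` of characteristic `p`, `g` an arithmetic Frobenius at `v` (the ONLY one in `Gal(L/F)`),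
degree one (`#(𝓞 F / v ∩ F) = p¹`), `v ∩ F` unramified in `L`, **and every `A i` with good reduction at `v`**.  Proof: G5
`exists_frobeniusPrime` at `S ∪ ⋃ᵢ Sᵢ`, `Sᵢ` the finite bad-reduction set of `A i` (`exists_finite_hasGoodReductionOutside_holds`,
spreading out; `AbelianVariety.isSmoothProjective_holds`). [cite: Shimura1998, §18.6 proof of Thm. 18.6, p. 128 conditions (1)–(4)] -/
theorem exists_frobeniusPrime_goodReduction {F L : Type} [Field F] [NumberField F] [Field L] [NumberField L]
    [Algebra F L] [IsGalois F L] (g : L ≃ₐ[F] L) {ι : Type} [Finite ι] (A : ι → AbelianVariety L)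
    {S : Set (HeightOneSpectrum (𝓞 L))} (hS : S.Finite) {M : ℕ} (hM : M ≠ 0) :
    ∃ (v : HeightOneSpectrum (𝓞 L)) (p : ℕ), v ∉ S ∧ p.Prime ∧ ¬ p ∣ M ∧ (p : 𝓞 L) ∈ v.asIdeal ∧
      (M : 𝓞 L) ∉ v.asIdeal ∧ (∀ d : ℕ, d ∣ M → (d : 𝓞 L) ∉ v.asIdeal) ∧ ExpChar v.asIdeal.ResidueField p ∧
      IsArithFrobAt (𝓞 F) g v.asIdeal ∧ Nat.card (𝓞 F ⧸ v.asIdeal.under (𝓞 F)) = p ^ 1 ∧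
      Algebra.IsUnramifiedIn (𝓞 L) (v.asIdeal.under (𝓞 F)) ∧
      (∀ φ : L ≃ₐ[F] L, IsArithFrobAt (𝓞 F) φ v.asIdeal → φ = g) ∧
      ∀ i, HasGoodReductionAt (A i).X (A i).dim v := by
  classical
  -- the finite bad-reduction sets of the members (spreading out)
  have hbad : ∀ i, ∃ Sᵢ : Set (HeightOneSpectrum (𝓞 L)), Sᵢ.Finite ∧ HasGoodReductionOutside (A i).X (A i).dim Sᵢ :=
    fun i => exists_finite_hasGoodReductionOutside_holds (X := (A i).X) (n := (A i).dim)
      AbelianVariety.isSmoothProjective_holds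
  choose T hTf hTgood using hbad
  have hfin : (S ∪ ⋃ i, T i).Finite := hS.union (Set.finite_iUnion hTf)
  obtain ⟨v, p, hvS, hp, hpM, hpv, hMv, hexp, hfrob, hq, hunr, huniq⟩ := exists_frobeniusPrime g hfin hM
  refine ⟨v, p, fun h => hvS (Or.inl h), hp, hpM, hpv, hMv, ?_, hexp, hfrob, hq, hunr, huniq, fun i => ?_⟩
  · -- `d ∣ M` and `(M) ∉ v` give `(d) ∉ v`
    intro d hdM hdv
    obtain ⟨c, hc⟩ := hdM
    exact hMv (by rw [hc, Nat.cast_mul]; exact v.asIdeal.mul_mem_right _ hdv)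
  · exact hTgood i v fun h => hvS (Or.inr (Set.mem_iUnion.2 ⟨i, h⟩))

/-- **Shimura's prime `𝔓` together with EVERY reduction datum of the family at `𝔓`, at every prime `ℓ' ∤ 𝔓` (G5 ∘ G8 in one
existential).**  From the three reduction-theory named facts AS HYPOTHESES (`hGR`, `hHR`, `hS5c` = the line's `FactGR` / `FactHR` /
`FactS5c` verbatim), for `g ∈ Gal(L/F)`, a finite family `A : ι → AbelianVariety L` with a distinguished index `a`, a finite set `S`
of places and `M ≠ 0`: a place `v ∉ S` of residue characteristic `p ∤ M` (`(p) ⊆ v`, `(M) ∉ v`, `(d) ∉ v` for all `d ∣ M`),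
`[ExpChar κ(v) p]`, `hγ : g` is an arithmetic Frobenius at `v` (the only one), `hq : #(𝓞 F / v ∩ F) = p¹`, `v ∩ F` unramified, good
reduction of every member at `v`, the `ℓ`-free data `R i`, `H i j`, `Hγ i : A i → (A a)^g`, `Hγ' i : (A a)^g → A i` for the
constructed datum `(R a).conjFrob g hγ p 1 hq`, AND for every prime `ℓ` with `(ℓ) ∉ v`: one common system `T i`, `Tγ` of `ℓ`-adic
specialisations, `σ̃ ∈ Aut(L̄)` over `g` with (σ-b), every Tate compatibility, and the geometric torsion clause (2′) — the body of
`HomReduction.exists_isTateCompatible_family_conjFrob` at `(γ, n) := (g, 1)`, character for character.  Proof: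
`exists_frobeniusPrime_goodReduction` then `exists_levelReductionData_family_forall_prime`.
[cite: Shimura1998, §18.6 proof of Thm. 18.6, pp. 128–129; §11.1 Prop. 12, Prop. 14 (i)] -/
theorem exists_frobeniusPrime_levelReductionData
    (hGR : ∀ {k : Type} [Field k] [NumberField k] (A₀ : AbelianVariety k) (v : HeightOneSpectrum (𝓞 k)),
      AbelianVariety.nonempty_goodReductionAt A₀ v)
    (hHR : ∀ {k : Type} [Field k] [NumberField k] {A₀ B₀ : AbelianVariety k} {v : HeightOneSpectrum (𝓞 k)}
      (R : A₀.GoodReductionAt v) (S : B₀.GoodReductionAt v), HomReduction.nonempty_homReduction R S)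
    (hS5c : ∀ {F₀ k : Type} [Field F₀] [NumberField F₀] [Field k] [NumberField k] [Algebra F₀ k]
      {v : HeightOneSpectrum (𝓞 k)} {ι : Type} {A : ι → AbelianVariety k}
      (R : ∀ i, (A i).GoodReductionAt v) (H : ∀ i j, HomReduction (R i) (R j)) (a : ι)
      (γ : k ≃ₐ[F₀] k) (hγ : IsArithFrobAt (𝓞 F₀) γ v.asIdeal) (p n : ℕ) [ExpChar v.asIdeal.ResidueField p]
      (hq : Nat.card (𝓞 F₀ ⧸ v.asIdeal.under (𝓞 F₀)) = p ^ n)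
      (Hγ : ∀ i, HomReduction (R i) ((R a).conjFrob γ hγ p n hq))
      (Hγ' : ∀ i, HomReduction ((R a).conjFrob γ hγ p n hq) (R i)) (ℓ : ℕ) [Fact ℓ.Prime],
      HomReduction.exists_isTateCompatible_family_conjFrob R H a γ hγ p n hq Hγ Hγ' ℓ)
    {F L : Type} [Field F] [NumberField F] [Field L] [NumberField L]
    [Algebra F L] [IsGalois F L] (g : L ≃ₐ[F] L) {ι : Type} [Finite ι] (A : ι → AbelianVariety L) (a : ι)
    {S : Set (HeightOneSpectrum (𝓞 L))} (hS : S.Finite) {M : ℕ} (hM : M ≠ 0) :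
    ∃ (v : HeightOneSpectrum (𝓞 L)) (p : ℕ) (_ : ExpChar v.asIdeal.ResidueField p)
      (hγ : IsArithFrobAt (𝓞 F) g v.asIdeal) (hq : Nat.card (𝓞 F ⧸ v.asIdeal.under (𝓞 F)) = p ^ 1),
      v ∉ S ∧ p.Prime ∧ ¬ p ∣ M ∧ (p : 𝓞 L) ∈ v.asIdeal ∧ (M : 𝓞 L) ∉ v.asIdeal ∧
      (∀ d : ℕ, d ∣ M → (d : 𝓞 L) ∉ v.asIdeal) ∧
      Algebra.IsUnramifiedIn (𝓞 L) (v.asIdeal.under (𝓞 F)) ∧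
      (∀ φ : L ≃ₐ[F] L, IsArithFrobAt (𝓞 F) φ v.asIdeal → φ = g) ∧
      (∀ i, HasGoodReductionAt (A i).X (A i).dim v) ∧
      ∃ (R : ∀ i, (A i).GoodReductionAt v) (H : ∀ i j, HomReduction (R i) (R j))
        (Hγ : ∀ i, HomReduction (R i) ((R a).conjFrob g hγ p 1 hq))
        (Hγ' : ∀ i, HomReduction ((R a).conjFrob g hγ p 1 hq) (R i)),
        ∀ (ℓ : ℕ) [Fact ℓ.Prime] (hℓv : (ℓ : 𝓞 L) ∉ v.asIdeal),
        ∃ (T : ∀ i, (R i).TateSpecialisation ℓ) (Tγ : ((R a).conjFrob g hγ p 1 hq).TateSpecialisation ℓ)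
        (σ' : AlgebraicClosure L ≃+* AlgebraicClosure L)
        -- (σ-a) `σ̃` extends `γ`
        (hσa : ∀ x : L, σ' (algebraMap L (AlgebraicClosure L) x) = algebraMap L (AlgebraicClosure L) (g.toRingEquiv x)),
        -- (σ-b) `σ̃` is the `q`-th power map on the `ℓ`-power roots of unity
        (∀ (m : ℕ) (ζ : AlgebraicClosure L), ζ ^ (ℓ ^ m) = 1 → σ' ζ = ζ ^ (p ^ 1)) ∧
        -- (1) one common prime; Tate compatibility of all pair data [§11.1 Prop. 14 (i)]
        (∀ i j, (T i).prime = (T j).prime) ∧ (∀ i, Tγ.prime = (T i).prime) ∧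
        (∀ i j, (H i j).IsTateCompatible (T i) (T j)) ∧
        (∀ i, (Hγ i).IsTateCompatible (T i) Tγ) ∧ (∀ i, (Hγ' i).IsTateCompatible Tγ (T i)) ∧
        -- (2′) the GEOMETRIC torsion clause «(x^σ̃)~ = π(x̃)» on (A a)[ℓᵐ](K̄), the conjugate point read through (A^γ) ⊗ K̄ ≅ (A ⊗ K̄)^σ̃
        (∀ (m : ℕ) (x : (A a).geomTorsion (ℓ ^ m : ℕ)) (x' : ((A a).conjugate g.toRingEquiv).geomTorsion (ℓ ^ m : ℕ)),
          Additive.toMul (x' : ((A a).conjugate g.toRingEquiv).geomPoints) =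
            (((A a).conjugate g.toRingEquiv).pointsMulEquiv (AlgebraicClosure L)).symm
              (AlgPoints.map (conjugateBaseChangeAlongIso g.toRingEquiv σ' hσa (A a)).inv.hom.hom.hom
                (((A a).baseChange (AlgebraicClosure L)).conjPoints σ'
                  ((A a).pointsMulEquiv (AlgebraicClosure L) (Additive.toMul (x : (A a).geomPoints))))) →
          (Tγ.reductionTorsionEquiv hℓv m x' : ((R a).conjFrob g hγ p 1 hq).reduction.geomPoints) =
            Hom.geomPointsMap ((R a).reduction.relFrobenius p 1)
              ((T a).reductionTorsionEquiv hℓv m x : (R a).reduction.geomPoints)) := by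
  obtain ⟨v, p, hvS, hp, hpM, hpv, hMv, hdv, hexp, hfrob, hq, hunr, huniq, hgood⟩ :=
    exists_frobeniusPrime_goodReduction g A hS hM
  haveI := hexp
  obtain ⟨R, H, Hγ, Hγ', hdata⟩ :=
    exists_levelReductionData_family_forall_prime hGR hHR hS5c A hgood a g hfrob p 1 hq
  exact ⟨v, p, hexp, hfrob, hq, hvS, hp, hpM, hpv, hMv, hdv, hunr, huniq, hgood, R, H, Hγ, Hγ',
    fun ℓ _ hℓv => hdata ℓ hℓv⟩

end Literature.NumberTheory.ComplexMultiplication
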